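import Summits.FinalStateConjecture.FinalStateConjecture.Theorems.ClusterCompletenessAdiabaticMultiKerrILEDSliceLeafCorrespondence
import Summits.FinalStateConjecture.FinalStateConjecture.Theorems.ClusterCompletenessAdiabaticMultiKerrILEDLateTransport
import Summits.FinalStateConjecture.FinalStateConjecture.Theorems.ClusterCompletenessAdiabaticMultiKerrILEDLateCollar
import HarnessLib

/-!
# Route ClusterCompleteness — crux `AdiabaticMultiKerrILED`, line `Sketch`:
# the lab transport of the single-zone, zero-spin far-energy bound

Helper file for the crux `stmt-FinalStateConjecture-14310`
(`Summit.FinalStateConjecture.FinalStateConjecture.Theses.ClusterCompleteness.AdiabaticMultiKerrILED`),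
line `Sketch`, stub `singleZoneFarEnergyBound_zeroSpin_of_rest` (lead c7, wave 2).

Setting: ONE tails-cut zero-spin zone of mass `M₀ > 0` in inertial motion (`u = Λe₀`,
`q = poincareInv Λ (0, p)`, lab speed `‖u⃗‖ ≤ u⁰/2`), lab coefficient field
`G^{μν} = η^{μν} − χ(q ·) 2H(q ·) (Λℓ♯(q ·))^μ (Λℓ♯(q ·))^ν` (a `Fin 1`-sum), exterior energy
`E[φ](t) = ∫_{r₊ < r(q(t,y))} Σ_μ (∂_μ φ)²(t, y) dy`.

* `singleZoneFarEnergyBound_zeroSpin_of_rest` — **the registered stub**: from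
  (hPB) the Poincaré pull-back statement (the rest-frame function `Φ = ψ ∘ P`, `P w = Λ w + (0, p)`,
  of a smooth lab solution `ψ` solves the rest-frame tails-cut equation at the rest points `z` with
  `(P z)⁰ ≥ 0`, `r₊ < r(z)`) and (hRest) the rest-frame far-energy bound on tilted leaves
  `{x⁰ = s + F(x⃗)}` (`F ∈ C²`, slope `≤ 1/2`) for the `a = 0` zone, the lab-frame far-energy bound
  `∫_{lab slice t, r ≥ r₊ + ηM₀} Σ(∂ψ)² ≤ C_lab · E[ψ](0)` for `t ≥ 0`, with speed threshold
  `v₀ = 1/2`, `t₁ = 0` and `C_lab = κ² C(η)`.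
  Proof: the slice/leaf correspondence `stub_sliceLeafCorrespondence` gives the linear height `F`
  (slope `≤ 1/2`), the Jacobian `J` and the gradient-comparability constant `κ`; the lab slice
  `{x⁰ = t}` is the rest-frame leaf `{z⁰ = t/u⁰ + F(z⃗)}`; `r₊(M₀, 0) = 2M₀`; the leaf condition
  `F(z⃗) ≤ z⁰` says `(P z)⁰ ≥ 0`, so hPB feeds hRest; and the two sides are transported between the
  lab slice and the leaf by the change of variables (`J` cancels) and the comparability (`κ` twice).

Special relativity folklore (O'Neill 1983, Ch. 9, pp. 233–236: Poincaré maps) and Lebesgue-integral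
bookkeeping; Dafermos–Rodnianski arXiv:0811.0354, §3.3.4 for the shape of the argument. [folklore]
-/

noncomputable section

-- the doubled `FinalStateConjecture.FinalStateConjecture` path component trips dupNamespace
set_option linter.dupNamespace false

open scoped ContDiff Topology BigOperators ENNReal
open Set MeasureTheory Literature.Geometry.Lorentzian
open Summit.FinalStateConjecture.FinalStateConjecture.Cruxes.AdiabaticMultiKerrILED.Sketch

namespace Summit.FinalStateConjecture.FinalStateConjecture.Theorems

/-- **Leaf integrals in indicator form.** For a continuous leaf map `r : E3 → E4` (here
`y ↦ (σ + F(y), y)`), a measurable `S ⊆ E4` and any density `e ≥ 0`: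
`∫ (1_S e)(r y) dy = ∫_{y | r y ∈ S} e(r y) dy`. [folklore] -/
theorem lintegral_indicator_comp_eq_setLIntegral {S : Set E4} (hS : MeasurableSet S)
    (e : E4 → ℝ≥0∞) {r : E3 → E4} (hr : Continuous r) :
    ∫⁻ y, S.indicator e (r y) = ∫⁻ y in {y : E3 | r y ∈ S}, e (r y) := by
  have hm : MeasurableSet {y : E3 | r y ∈ S} := hS.preimage hr.measurable
  rw [← lintegral_indicator hm]
  exact lintegral_congr fun y ↦ (Set.indicator_comp_right r).symm

/-- **The single-zone, zero-spin far-energy bound in the lab frame, from the rest-frame bound**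
(stub FB of line `Sketch` at `N = 1`, `a = 0`). Given (hPB) the Poincaré pull-back statement for one
boosted tails-cut zone and (hRest) the rest-frame far-energy bound on tilted leaves of slope `≤ 1/2`
for the zero-spin tails-cut field, there is `v₀ > 0` (`v₀ = 1/2`) such that for every single
zero-spin zone in inertial motion with lab speed `≤ v₀ u⁰`, every `η > 0`, and every smooth lab
solution `ψ` of `Σ_μ ∂_μ(Σ_ν G^{μν} ∂_ν ψ) = 0` on `{x⁰ ≥ 0} ∩ {r₊ < r}`:
`∫_{t-slice ∩ {r ≥ r₊ + ηM₀}} Σ(∂ψ)² ≤ C E[ψ](0)` for all `t ≥ t₁ = 0`, with `C = κ² C_rest(η)`.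
The lab slice `{x⁰ = t}` is the rest-frame leaf `{z⁰ = t/u⁰ + F(z⃗)}` of the linear height `F` of
`stub_sliceLeafCorrespondence`; `r₊(M₀, 0) = 2M₀`; `F(z⃗) ≤ z⁰ ⇔ (Λz + (0,p))⁰ ≥ 0`; the change of
variables `∫ g(q(t,y)) dy = J ∫ g(t/u⁰ + F(y'), y') dy'` and the `κ`-comparability of the coordinate
gradients of `ψ` and `ψ ∘ P` transport both sides (O'Neill 1983, Ch. 9, pp. 233–236;
Dafermos–Rodnianski arXiv:0811.0354, §3.3.4). [folklore] -/
theorem singleZoneFarEnergyBound_zeroSpin_of_rest :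
    (∀ (M a : ℝ) (Λ : lorentzGroup) (p : E3) (q : E4 → E4) (G : E4 → Fin 4 → Fin 4 → ℝ) (ψ : E4 → ℝ),
      (∀ x, q x = poincareInv Λ (E4.ofTimeSpace 0 p) x) → 0 < M → |a| < M →
      (∀ x μ ν, G x μ ν = Minkowski.bilin (E4.basisVector μ) (E4.basisVector ν) -
        Real.smoothTransition (2 - Kerr.radius a (q x) / (8 * M)) * (2 * Kerr.scalarH M a (q x)) *
          ((Λ : E4 ≃L[ℝ] E4) (Kerr.nullVector a (q x))) μ * ((Λ : E4 ≃L[ℝ] E4) (Kerr.nullVector a (q x))) ν) →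
      ContDiff ℝ ∞ ψ →
      (∀ x : E4, 0 ≤ x 0 → Kerr.rPlus M a < Kerr.radius a (q x) →
        ∑ μ : Fin 4, fderiv ℝ (fun y ↦ ∑ ν : Fin 4, G y μ ν * fderiv ℝ ψ y (E4.basisVector ν)) x
          (E4.basisVector μ) = 0) →
      ∀ z : E4, 0 ≤ ((Λ : E4 ≃L[ℝ] E4) z + E4.ofTimeSpace 0 p) 0 → Kerr.rPlus M a < Kerr.radius a z →
        KerrSchild.waveOperator
          (KerrSchild.inverseMetric
            (fun y ↦ Real.smoothTransition (2 - Kerr.radius a y / (8 * M)) * (2 * Kerr.scalarH M a y))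
            (Kerr.nullVector a))
          (fun w ↦ ψ ((Λ : E4 ≃L[ℝ] E4) w + E4.ofTimeSpace 0 p)) z = 0) →
    (∀ (M η : ℝ), 0 < M → 0 < η → ∃ C : NNReal,
      ∀ (F : E3 → ℝ) (Φ : E4 → ℝ), ContDiff ℝ 2 F → (∀ y, ‖fderiv ℝ F y‖ ≤ 2⁻¹) → ContDiff ℝ 2 Φ →
      (∀ x : E4, F (E4.spatial x) ≤ x 0 → 2 * M < Kerr.radius 0 x →
        KerrSchild.waveOperator
          (KerrSchild.inverseMetric
            (fun y ↦ Real.smoothTransition (2 - Kerr.radius 0 y / (8 * M)) * (2 * Kerr.scalarH M 0 y))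
            (Kerr.nullVector 0)) Φ x = 0) →
      ∀ s : ℝ, 0 ≤ s →
        ∫⁻ y in {y : E3 | (2 + η) * M ≤ Kerr.radius 0 (E4.ofTimeSpace (s + F y) y)},
            ENNReal.ofReal (∑ μ : Fin 4, (fderiv ℝ Φ (E4.ofTimeSpace (s + F y) y) (E4.basisVector μ)) ^ 2) ≤
          (C : ENNReal) * ∫⁻ y in {y : E3 | 2 * M < Kerr.radius 0 (E4.ofTimeSpace (0 + F y) y)},
            ENNReal.ofReal (∑ μ : Fin 4, (fderiv ℝ Φ (E4.ofTimeSpace (0 + F y) y) (E4.basisVector μ)) ^ 2)) →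
    ∃ v₀ : ℝ, 0 < v₀ ∧
    ∀ (M : Fin 1 → ℝ) (Λ : Fin 1 → lorentzGroup) (p : Fin 1 → E3) (u : Fin 1 → E4) (q : Fin 1 → E4 → E4),
      (∀ i, u i = (Λ i : E4 ≃L[ℝ] E4) (E4.basisVector 0)) →
      (∀ i x, q i x = poincareInv (Λ i) (E4.ofTimeSpace 0 (p i)) x) →
      (∀ i, 0 < M i) → (∀ i, 0 < u i 0 ∧ ‖E4.spatial (u i)‖ ≤ v₀ * u i 0) →
      ∀ (G : E4 → Fin 4 → Fin 4 → ℝ),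
      (∀ x μ ν, G x μ ν = Minkowski.bilin (E4.basisVector μ) (E4.basisVector ν) -
        ∑ i, Real.smoothTransition (2 - Kerr.radius 0 (q i x) / (8 * M i)) *
          (2 * Kerr.scalarH (M i) 0 (q i x)) *
          ((Λ i : E4 ≃L[ℝ] E4) (Kerr.nullVector 0 (q i x))) μ *
          ((Λ i : E4 ≃L[ℝ] E4) (Kerr.nullVector 0 (q i x))) ν) →
      ∀ (E : (E4 → ℝ) → ℝ → ENNReal),
      (∀ φ t, E φ t = ∫⁻ y in {y : E3 | ∀ i, Kerr.rPlus (M i) 0 <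
          Kerr.radius 0 (q i (E4.ofTimeSpace t y))},
        ENNReal.ofReal (∑ μ : Fin 4, (fderiv ℝ φ (E4.ofTimeSpace t y) (E4.basisVector μ)) ^ 2)) →
      ∀ η : ℝ, 0 < η → ∃ (t₁ : ℝ) (C : NNReal), ∀ ψ : E4 → ℝ, ContDiff ℝ ∞ ψ →
        (∀ x : E4, 0 ≤ x 0 → (∀ i, Kerr.rPlus (M i) 0 < Kerr.radius 0 (q i x)) →
          ∑ μ : Fin 4, fderiv ℝ (fun y ↦ ∑ ν : Fin 4, G y μ ν * fderiv ℝ ψ y (E4.basisVector ν)) x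
            (E4.basisVector μ) = 0) →
        ∀ t : ℝ, t₁ ≤ t →
          ∫⁻ y in {y : E3 | ∀ i, Kerr.rPlus (M i) 0 + η * M i ≤ Kerr.radius 0 (q i (E4.ofTimeSpace t y))},
            ENNReal.ofReal (∑ μ : Fin 4, (fderiv ℝ ψ (E4.ofTimeSpace t y) (E4.basisVector μ)) ^ 2) ≤
          (C : ENNReal) * E ψ 0 := by
  intro hPB hRest
  refine ⟨2⁻¹, by norm_num, ?_⟩
  intro M Λ p u q hu hq hM hv G hG E hE η hη
  -- ### single-zone data: slice/leaf correspondence, rest-frame constant, `r₊ = 2M₀`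
  have hu0 : 0 < u 0 0 := (hv 0).1
  obtain ⟨F, J, κ, -, hκ, hF, hFslope, hSL1, hSL2, -, hSL4⟩ :=
    stub_sliceLeafCorrespondence (Λ 0) (p 0) (u 0) (q 0) (hu 0) (hq 0) hu0 (hv 0).2
  obtain ⟨C, hC⟩ := hRest (M 0) η (hM 0) hη
  have hr : Kerr.rPlus (M 0) 0 = 2 * M 0 := Kerr.rPlus_zero_right (hM 0).le
  have hF2 : ContDiff ℝ 2 F := by have := contDiff_infty.1 hF 2; exact_mod_cast this
  have hqP : ∀ w, q 0 ((Λ 0 : E4 ≃L[ℝ] E4) w + E4.ofTimeSpace 0 (p 0)) = w := fun w ↦ by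
    rw [hq 0, poincareInv, add_sub_cancel_right, ContinuousLinearEquiv.symm_apply_apply]
  have hqc : Continuous (q 0) := by
    rw [show q 0 = poincareInv (Λ 0) (E4.ofTimeSpace 0 (p 0)) from funext (hq 0)]
    exact continuous_poincareInv _ _
  have hgraph : ∀ σ : ℝ, Continuous fun y : E3 ↦ E4.ofTimeSpace (σ + F y) y := fun σ ↦
    E4.continuous_ofTimeSpace' (continuous_const.add hF.continuous) continuous_id
  -- the patched field is the single boosted tails-cut field of zone `0`
  have hG1 : ∀ x μ ν, G x μ ν = Minkowski.bilin (E4.basisVector μ) (E4.basisVector ν) -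
      Real.smoothTransition (2 - Kerr.radius 0 (q 0 x) / (8 * M 0)) * (2 * Kerr.scalarH (M 0) 0 (q 0 x)) *
        ((Λ 0 : E4 ≃L[ℝ] E4) (Kerr.nullVector 0 (q 0 x))) μ *
        ((Λ 0 : E4 ≃L[ℝ] E4) (Kerr.nullVector 0 (q 0 x))) ν := fun x μ ν ↦ by
    rw [hG, Fin.sum_univ_one]
  refine ⟨0, Real.toNNReal (κ * κ) * C, ?_⟩
  intro ψ hψ hsol t ht
  -- ### one solution: the rest-frame pull-back `Φ = ψ ∘ P`
  have hψ1 : ContDiff ℝ 1 ψ := by have := contDiff_infty.1 hψ 1; exact_mod_cast this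
  set Φ : E4 → ℝ := fun w ↦ ψ ((Λ 0 : E4 ≃L[ℝ] E4) w + E4.ofTimeSpace 0 (p 0)) with hΦ
  have hΦs : ContDiff ℝ ∞ Φ :=
    hψ.comp ((((Λ 0 : E4 ≃L[ℝ] E4) : E4 →L[ℝ] E4).contDiff).add contDiff_const)
  have hΦ1 : ContDiff ℝ 1 Φ := by have := contDiff_infty.1 hΦs 1; exact_mod_cast this
  have hΦ2 : ContDiff ℝ 2 Φ := by have := contDiff_infty.1 hΦs 2; exact_mod_cast this
  -- the lab equation in single-zone form
  have hsol1 : ∀ x : E4, 0 ≤ x 0 → Kerr.rPlus (M 0) 0 < Kerr.radius 0 (q 0 x) →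
      ∑ μ : Fin 4, fderiv ℝ (fun y ↦ ∑ ν : Fin 4, G y μ ν * fderiv ℝ ψ y (E4.basisVector ν)) x
        (E4.basisVector μ) = 0 :=
    fun x hx0 hxr ↦ hsol x hx0 (Fin.forall_fin_one.2 hxr)
  -- the rest-frame equation for `Φ` on `{F(z⃗) ≤ z⁰} ∩ {2M₀ < r}` (hPB)
  have hΦeq : ∀ z : E4, F (E4.spatial z) ≤ z 0 → 2 * M 0 < Kerr.radius 0 z →
      KerrSchild.waveOperator
        (KerrSchild.inverseMetric
          (fun y ↦ Real.smoothTransition (2 - Kerr.radius 0 y / (8 * M 0)) * (2 * Kerr.scalarH (M 0) 0 y))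
          (Kerr.nullVector 0)) Φ z = 0 := by
    intro z hzF hzr
    have habs : |(0 : ℝ)| < M 0 := by rw [abs_zero]; exact hM 0
    refine hPB (M 0) 0 (Λ 0) (p 0) (q 0) G ψ (hq 0) (hM 0) habs hG1 hψ hsol1 z ?_ (by rwa [hr])
    -- `(P z)⁰ ≥ 0` is the leaf condition `F(z⃗) ≤ z⁰`
    have h1 := hSL1 ((Λ 0 : E4 ≃L[ℝ] E4) z + E4.ofTimeSpace 0 (p 0))
    rw [hqP] at h1
    have h2 : 0 ≤ (u 0 0)⁻¹ * ((Λ 0 : E4 ≃L[ℝ] E4) z + E4.ofTimeSpace 0 (p 0)) 0 := by linarith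
    exact (mul_nonneg_iff_of_pos_left (inv_pos.2 hu0)).1 h2
  -- the rest-frame far-energy bound for `Φ` along the leaves of `F`
  have hRC := hC F Φ hF2 hFslope hΦ2 hΦeq
  -- ### notation for the transport
  set e : E4 → ℝ≥0∞ := fun z ↦ ENNReal.ofReal (∑ μ : Fin 4, (fderiv ℝ Φ z (E4.basisVector μ)) ^ 2)
    with he
  set S₁ : Set E4 := {z : E4 | (2 + η) * M 0 ≤ Kerr.radius 0 z} with hS₁
  set S₂ : Set E4 := {z : E4 | 2 * M 0 < Kerr.radius 0 z} with hS₂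
  have hS₁m : MeasurableSet S₁ := measurableSet_le measurable_const (Kerr.continuous_radius 0).measurable
  have hS₂m : MeasurableSet S₂ := measurableSet_lt measurable_const (Kerr.continuous_radius 0).measurable
  -- comparability of the lab and rest-frame densities
  have hcmp : ∀ x : E4, e (q 0 x) ≤ ENNReal.ofReal κ *
      ENNReal.ofReal (∑ μ : Fin 4, (fderiv ℝ ψ x (E4.basisVector μ)) ^ 2) := fun x ↦ by
    rw [he, ← ENNReal.ofReal_mul hκ.le]
    exact ENNReal.ofReal_le_ofReal (hSL4 ψ x (hψ.differentiable (by simp)).differentiableAt).1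
  have hcmp' : ∀ x : E4, ENNReal.ofReal (∑ μ : Fin 4, (fderiv ℝ ψ x (E4.basisVector μ)) ^ 2) ≤
      ENNReal.ofReal κ * e (q 0 x) := fun x ↦ by
    rw [he, ← ENNReal.ofReal_mul hκ.le]
    exact ENNReal.ofReal_le_ofReal (hSL4 ψ x (hψ.differentiable (by simp)).differentiableAt).2
  -- ### the lab far set at time `t` is the pre-image of `S₁` under `y ↦ q(t, y)`
  have hTeq : {y : E3 | ∀ i, Kerr.rPlus (M i) 0 + η * M i ≤ Kerr.radius 0 (q i (E4.ofTimeSpace t y))} =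
      {y : E3 | q 0 (E4.ofTimeSpace t y) ∈ S₁} := by
    ext y
    simp only [Set.mem_setOf_eq, Fin.forall_fin_one, hr, hS₁]
    constructor <;> intro h <;> linarith
  have hTm : MeasurableSet {y : E3 | q 0 (E4.ofTimeSpace t y) ∈ S₁} :=
    hS₁m.preimage (hqc.comp (E4.continuous_ofTimeSpace t)).measurable
  have hT0m : MeasurableSet {y : E3 | ∀ i, Kerr.rPlus (M i) 0 < Kerr.radius 0 (q i (E4.ofTimeSpace 0 y))} := by
    have h : {y : E3 | ∀ i, Kerr.rPlus (M i) 0 < Kerr.radius 0 (q i (E4.ofTimeSpace 0 y))} =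
        {y : E3 | q 0 (E4.ofTimeSpace 0 y) ∈ S₂} := by
      ext y
      simp only [Set.mem_setOf_eq, Fin.forall_fin_one, hr, hS₂]
    rw [h]
    exact hS₂m.preimage (hqc.comp (E4.continuous_ofTimeSpace 0)).measurable
  have hg0m : Measurable fun y : E3 ↦
      ENNReal.ofReal (∑ μ : Fin 4, (fderiv ℝ ψ (E4.ofTimeSpace 0 y) (E4.basisVector μ)) ^ 2) :=
    (measurable_energyDensity hψ1).comp (E4.continuous_ofTimeSpace 0).measurable
  -- ### the leaf parameter of the lab slice `t`
  have hs : 0 ≤ (u 0 0)⁻¹ * t := mul_nonneg (inv_nonneg.2 hu0.le) ht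
  -- the initial lab slice is the leaf `0`
  have h0 : ∫⁻ y : E3, S₂.indicator e (q 0 (E4.ofTimeSpace 0 y)) =
      ENNReal.ofReal J * ∫⁻ y' : E3, S₂.indicator e (E4.ofTimeSpace (0 + F y') y') := by
    rw [hSL2 (S₂.indicator e) 0, mul_zero]
  have hE0 : ∫⁻ y : E3, S₂.indicator e (q 0 (E4.ofTimeSpace 0 y)) ≤ ENNReal.ofReal κ * E ψ 0 := by
    rw [hE ψ 0]
    refine lintegral_indicator_comp_le_setLIntegral hT0m hg0m fun y hy ↦ ⟨?_, hcmp _⟩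
    refine Fin.forall_fin_one.2 ?_
    rw [hr]
    exact hy
  -- ### the chain
  calc ∫⁻ y in {y : E3 | ∀ i, Kerr.rPlus (M i) 0 + η * M i ≤ Kerr.radius 0 (q i (E4.ofTimeSpace t y))},
        ENNReal.ofReal (∑ μ : Fin 4, (fderiv ℝ ψ (E4.ofTimeSpace t y) (E4.basisVector μ)) ^ 2)
      = ∫⁻ y in {y : E3 | q 0 (E4.ofTimeSpace t y) ∈ S₁},
          ENNReal.ofReal (∑ μ : Fin 4, (fderiv ℝ ψ (E4.ofTimeSpace t y) (E4.basisVector μ)) ^ 2) := by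
        rw [hTeq]
    _ ≤ ENNReal.ofReal κ * ∫⁻ y : E3, S₁.indicator e (q 0 (E4.ofTimeSpace t y)) :=
        setLIntegral_le_lintegral_indicator_comp hTm ENNReal.ofReal_ne_top fun y hy ↦ ⟨hy, hcmp' _⟩
    _ = ENNReal.ofReal κ * (ENNReal.ofReal J *
          ∫⁻ y' in {y' : E3 | E4.ofTimeSpace ((u 0 0)⁻¹ * t + F y') y' ∈ S₁},
            e (E4.ofTimeSpace ((u 0 0)⁻¹ * t + F y') y')) := by
        rw [hSL2 (S₁.indicator e) t, lintegral_indicator_comp_eq_setLIntegral hS₁m e (hgraph _)]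
    _ ≤ ENNReal.ofReal κ * (ENNReal.ofReal J * ((C : ℝ≥0∞) *
          ∫⁻ y' in {y' : E3 | E4.ofTimeSpace (0 + F y') y' ∈ S₂}, e (E4.ofTimeSpace (0 + F y') y'))) := by
        gcongr
        exact hRC _ hs
    _ = ENNReal.ofReal κ * (C : ℝ≥0∞) *
          (ENNReal.ofReal J * ∫⁻ y' : E3, S₂.indicator e (E4.ofTimeSpace (0 + F y') y')) := by
        rw [lintegral_indicator_comp_eq_setLIntegral hS₂m e (hgraph 0)]
        ring
    _ = ENNReal.ofReal κ * (C : ℝ≥0∞) * ∫⁻ y : E3, S₂.indicator e (q 0 (E4.ofTimeSpace 0 y)) := by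
        rw [h0]
    _ ≤ ENNReal.ofReal κ * (C : ℝ≥0∞) * (ENNReal.ofReal κ * E ψ 0) := by
        gcongr
    _ = ((Real.toNNReal (κ * κ) * C : NNReal) : ℝ≥0∞) * E ψ 0 := by
        rw [ENNReal.coe_mul, ← ENNReal.ofReal.eq_1, ENNReal.ofReal_mul hκ.le]
        ring

end Summit.FinalStateConjecture.FinalStateConjecture.Theorems

end
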